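import Literature.NumberTheory.EllipticCurves.ModularCurveRealPeriodProofs
import Literature.NumberTheory.EllipticCurves.ImaginaryPeriod
import HarnessLib

/-!
# The minus period ratio `ϖ⁻ = Ω⁻_f / |Ω⁻(W)|` is a positive rational number (cell `b2b-bsdres`, seat additive-p4, line V9)

HONEST FRAMING (cell `b2b-bsdres`, run/shared/lean/b2b/bsd-rank1-residual/, verbatim in every
file): the goal of the cell is to DELETE the COMBINATION-SHAPED residual classes of the
Birch–Swinnerton-Dyer formula for ALL analytic-rank `≤ 1` elliptic curves over `ℚ` — "full BSD
formula for every rank `≤ 1` curve in class `C`" assembled STRICTLY from published theorems — so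
that the rank-`≤ 1` remainder becomes exactly the CONSTRUCTION-SHAPED classes, which are TYPED
(missing-input `Prop`s), NOT attempted. This is not "finishing BSD". The additive sub-cell (seats
additive-p1…p4) is a RESEARCH ROUTE on the construction-shaped classes X3/X4; no claim beyond the
stated classes; labels UNCHANGED.

Theorems only (no definition, no named fact). The odd-branch theorems of the line V9
(`SemistableTwistAnalyticOdd.lean`, `X3RankZeroSemistableTwistOdd.lean`,
`X4RankZeroSemistableTwistOdd.lean`) take a rational `ϖ⁻` with `ϖ⁻ · |Ω⁻(V)| = Ω⁻_f` (`f` the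
newform of `V`, `|Ω⁻(V)| = V.imaginaryPeriodRat` of the literature seat's `ImaginaryPeriod.lean`,
`Ω⁻_f = minusPeriod f` with `im Λ_f = ℤ·Ω⁻_f/2`). This file proves that such a `ϖ⁻` EXISTS for every
modular parametrisation datum `D` of `V` (minus twin of the tree's
`ModularParametrizationData.exists_rat_mul_realPeriodRat_eq_plusPeriod` /
`realPeriodRat_dvd_holds`): from `c · Λ_f ⊆ Λ_E` (Edixhoven 1991, §1: `φ^* ω_E = c · 2πi f dτ`;
the field `smul_periodLattice_le`) and `im Λ_E ⊆ ℤ · |Ω⁻(E)|/2` for the real lattice `Λ_E`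
(`z − z̄ = 2i·im z ∈ Λ_E ∩ iℝ = iℤ|Ω⁻(E)|`, tree `PeriodPair.IsReal.exists_im_eq_int_mul_half`):
`|c| · Ω⁻_f = m · |Ω⁻(E)|` with `0 < m ∈ ℤ`, so `ϖ⁻ = m/|c| ∈ ℚ_{>0}`.

* `imagPeriods_eq_zmultiples_of_minusPeriod_pos` — `Ω⁻_f > 0 ⇒ im Λ_f = ℤ·(Ω⁻_f/2)` (definition);
* `neronLattice_exists_im_eq_int_mul_imaginaryPeriodRat_div_two` — `im Λ_E ⊆ ℤ·|Ω⁻(W)|/2`;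
* `imaginaryPeriodRat_dvd_of_parametrization` — `∃ m > 0, m·|Ω⁻(W)| = |c|·Ω⁻_f`;
* `exists_rat_mul_imaginaryPeriodRat_eq_minusPeriod` — **`∃ ϖ⁻ ∈ ℚ_{>0}, ϖ⁻ · |Ω⁻(W)| = Ω⁻_f`**
  (all taking the datum `D : ModularParametrizationData W N` explicitly).

References: Edixhoven 1991 [EdixhovenManin1991] §1; Cremona 1997 [CremonaAlgorithms1997] §2.8
(p. 26), §2.10; Pal 2012 [Pal2012] p. 1514 (`Ω⁻`).
-/

noncomputable section

open scoped ComplexConjugate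
open Complex

namespace Summit.BirchSwinnertonDyer.Rank1Residual.Additive

open Literature.NumberTheory.EllipticCurves Literature.NumberTheory.EllipticCurves.ModularForms

section MinusPeriod

variable {N : ℕ} (f : CuspForm (CongruenceSubgroup.Gamma0 N) 2)

/-- If `Ω⁻_f > 0` (so `minusPeriod f` is not the junk value `0`) then `im Λ_f = ℤ · (Ω⁻_f/2)`, by the
definition of `minusPeriod` (Cremona §2.8). [cite: CremonaAlgorithms1997, §2.8 (p. 26)] -/
theorem imagPeriods_eq_zmultiples_of_minusPeriod_pos (h : 0 < minusPeriod f) :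
    imagPeriods f = AddSubgroup.zmultiples (minusPeriod f / 2) := by
  classical
  have hex : ∃ Ω : ℝ, 0 < Ω ∧ imagPeriods f = AddSubgroup.zmultiples (Ω / 2) := by
    by_contra hex
    simp [minusPeriod, dif_neg hex] at h
  simp only [minusPeriod, dif_pos hex]
  exact hex.choose_spec.2

end MinusPeriod

section Datum

variable {W : WeierstrassCurve ℚ} {N : ℕ} [NeZero N] (D : ModularParametrizationData W N)

/-- **`im Λ_E ⊆ ℤ · |Ω⁻(W)|/2`**: for the (real) Néron period lattice `Λ_E = D.L` of `W`,
`2i·im z = z − z̄ ∈ Λ_E ∩ iℝ = iℤ·|Ω⁻(W)|` (`|Ω⁻(W)| = W.imaginaryPeriodRat`, the least positive `t`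
with `it ∈ Λ_E`; tree `PeriodPair.IsReal.exists_im_eq_int_mul_half` and `imaginaryPeriod_eq`).
[cite: CremonaAlgorithms1997, §2.8 (p. 26)] [cite: Pal2012, p. 1514] -/
theorem neronLattice_exists_im_eq_int_mul_imaginaryPeriodRat_div_two [W.IsElliptic] {z : ℂ}
    (hz : z ∈ D.L.lattice) : ∃ k : ℤ, z.im = k * (W.imaginaryPeriodRat / 2) := by
  haveI : (W.baseChange ℝ).IsElliptic := by
    rw [WeierstrassCurve.baseChange]; infer_instance
  have hΩ : W.imaginaryPeriodRat = (D.L.mulLeft I I_ne_zero).minRealPeriod := by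
    rw [WeierstrassCurve.imaginaryPeriodRat_def]
    exact (W.baseChange ℝ).imaginaryPeriod_eq
      (by rw [D.neronLattice_g₂, ModularParametrizationData.baseChange_real_c₄])
      (by rw [D.neronLattice_g₃, ModularParametrizationData.baseChange_real_c₆])
  obtain ⟨k, hk⟩ := D.isReal_neronLattice.exists_im_eq_int_mul_half hz
  exact ⟨k, by rw [hΩ, hk]⟩

/-- **Minus period relation: `m · |Ω⁻(W)| = |c| · Ω⁻_f` with `0 < m`** (minus twin of
`realPeriodRat_dvd_holds`; Edixhoven 1991 §1: `c Λ_f ⊆ Λ_E`; Cremona §2.8): with `Ω⁻_f > 0`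
(`IsNewform0.minusPeriod_pos_holds`) pick `z ∈ Λ_f` with `im z = Ω⁻_f/2`; then `c z ∈ Λ_E`, so
`c Ω⁻_f/2 = k |Ω⁻(W)|/2` with `k ∈ ℤ ∖ {0}`; `m = |k|`. [cite: EdixhovenManin1991, §1]
[cite: CremonaAlgorithms1997, §2.8 (p. 26)] -/
theorem imaginaryPeriodRat_dvd_of_parametrization [W.IsElliptic] :
    ∃ m : ℕ, 0 < m ∧ (m : ℝ) * W.imaginaryPeriodRat = |(D.maninConstant : ℝ)| * minusPeriod D.f := by
  have hpos : 0 < minusPeriod D.f :=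
    IsNewform0.minusPeriod_pos_holds D.isNewformOf.1 D.isNewformOf.coeffField_eq_bot
  have him : imagPeriods D.f = AddSubgroup.zmultiples (minusPeriod D.f / 2) :=
    imagPeriods_eq_zmultiples_of_minusPeriod_pos D.f hpos
  have hmem : minusPeriod D.f / 2 ∈ imagPeriods D.f := by
    rw [him]
    exact AddSubgroup.mem_zmultiples _
  rw [imagPeriods, AddSubgroup.mem_map] at hmem
  obtain ⟨z, hz, hzim⟩ := hmem
  have hzim' : z.im = minusPeriod D.f / 2 := by simpa using hzim
  have hcz : (D.c : ℂ) * z ∈ D.L.lattice := D.smul_periodLattice_le z hz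
  obtain ⟨k, hk⟩ := neronLattice_exists_im_eq_int_mul_imaginaryPeriodRat_div_two D hcz
  have hmul : ((D.c : ℂ) * z).im = (D.c : ℝ) * z.im := by
    rw [Complex.mul_im, Complex.intCast_re, Complex.intCast_im, zero_mul, add_zero]
  rw [hmul, hzim'] at hk
  have hk' : (D.c : ℝ) * minusPeriod D.f = k * W.imaginaryPeriodRat := by linarith
  have hc : (D.c : ℝ) ≠ 0 := Int.cast_ne_zero.mpr D.maninConstant_ne_zero_holds
  have hk0 : k ≠ 0 := by
    rintro rfl
    rw [Int.cast_zero, zero_mul] at hk'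
    exact mul_ne_zero hc hpos.ne' hk'
  have hΩ : 0 ≤ W.imaginaryPeriodRat := (W.imaginaryPeriodRat_pos).le
  refine ⟨k.natAbs, Int.natAbs_pos.mpr hk0, ?_⟩
  have hcast : ((k.natAbs : ℕ) : ℝ) = |(k : ℝ)| := by
    rw [Nat.cast_natAbs, Int.cast_abs]
  change ((k.natAbs : ℕ) : ℝ) * W.imaginaryPeriodRat = |(D.c : ℝ)| * minusPeriod D.f
  rw [hcast, ← abs_of_nonneg hΩ, ← abs_mul, ← hk', abs_mul, abs_of_pos hpos]

/-- **The minus period ratio `ϖ⁻ = Ω⁻_f/|Ω⁻(W)|` is a positive rational number**: for a modular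
parametrisation datum `D` of `W` (newform `f = D.f`, Manin constant `c ≠ 0`) there is `ϖ⁻ ∈ ℚ_{>0}`
with `ϖ⁻ · |Ω⁻(W)| = Ω⁻_f` (`ϖ⁻ = m/|c|` from `imaginaryPeriodRat_dvd_of_parametrization`). This is the `ϖ⁻` the
odd-branch V9 theorems ask for. [cite: EdixhovenManin1991, §1] [cite: CremonaAlgorithms1997, §2.8 (p. 26)] -/
theorem exists_rat_mul_imaginaryPeriodRat_eq_minusPeriod [W.IsElliptic] :
    ∃ ϖ : ℚ, 0 < ϖ ∧ (ϖ : ℝ) * W.imaginaryPeriodRat = minusPeriod D.f := by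
  obtain ⟨m, hm, hmeq⟩ := imaginaryPeriodRat_dvd_of_parametrization D
  have hc : D.maninConstant ≠ 0 := D.maninConstant_ne_zero_holds
  have hcpos : 0 < |(D.maninConstant : ℝ)| := abs_pos.mpr (Int.cast_ne_zero.mpr hc)
  refine ⟨(m : ℚ) / |(D.maninConstant : ℚ)|, ?_, ?_⟩
  · have : (0 : ℚ) < |(D.maninConstant : ℚ)| := abs_pos.mpr (Int.cast_ne_zero.mpr hc)
    positivity
  · have hcast : (((m : ℚ) / |(D.maninConstant : ℚ)| : ℚ) : ℝ) = (m : ℝ) / |(D.maninConstant : ℝ)| := by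
      push_cast
      rfl
    rw [hcast, div_mul_eq_mul_div, hmeq, mul_div_cancel_left₀ _ hcpos.ne']

end Datum

end Summit.BirchSwinnertonDyer.Rank1Residual.Additive

end
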